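import Summits.QuantumFields.BalabanUV.Beta.FP.ExpLocalisedBubble

/-!
# `BalabanUV.Beta.FP.NearRegionCrossBubbleSmear` — road «FP» (binder row D1), organisation β of `RHOA-DESIGN.md` §3, row RHOA-3 (N-PC generic), PART 1b:
# THE CROSS SMEAR OF A TRANSLATION-INVARIANT LEG `F` AND A TWO-POINT LEG `R` AGAINST TWO EXPONENTIALLY LOCALISED VERTEX WEIGHTS — summability, the product
# letters, and THE DOUBLE ZERO-MASS IDENTITY ([folklore] lattice bookkeeping on `ℤ^D`; nothing of the manuscripts; no road object is typed or touched)

HONEST DEPENDENCY (page 1, mandatory): continuum YM on T⁴ ⇐ BetaPertH ∧ nine spine estimates (0/9 proved); BetaPertH ⇐ (D1) ∧ (D4) ∧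
CAP+tail; G-an2-4 gates asym, D1 and NE2/3/4.  HONEST FRAMING (cell contract, verbatim): «discharging `BetaPertH` makes Bałaban's UV
stability UNCONDITIONAL — a real constructive-QFT result; it is NOT the continuum limit and NOT the Clay problem.»  THIS MODULE is elementary [folklore]
real analysis in the H2-a currency of `FP/ExpLocalisedBubble` (beta-d1-formalise-leaf-02 g6: two-point weights `|c p| ≤ C·e^{−δ(|p.1|₁+|p.2|₁)}`, the letters
`summable_loc_mul_pow` ∕ `tsum_loc_mul_pow_le` ∕ `summable_weight`) and Mathlib's `Summable.mul_of_nonneg` ∕ `Summable.tsum_mul_tsum`.  Every analytic input is a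
HYPOTHESIS displayed in the signatures; the module cites nothing, defines nothing, mints no `Prop` fact, 0 sorry.  NOT the road's objects, NOT `ρ_n` bounded, NOT
`hasym`, NOT D1, NOT BetaPertH, NOT continuum, NOT Clay.

THE OBJECT (scalar fibre; fibres are finite sums of it — the consumer's).  For a translation-invariant leg `F : ℤ^D → ℝ`, a two-point leg
`R : ℤ^D → ℤ^D → ℝ`, a vertex weight `c₀` localised at `(0,0)` and a vertex weight `c₁` localised at `(z,z)` written in RELATIVE coordinates,
  `X(z) := Σ'_{q = ((y,u),(w′,x′))} c₀ (y,u) · c₁ (w′,x′) · F (z + x′ − y) · R u (z + w′)`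
= `tr((F∘V₀)∘(R∘W_z))` of `ExpKernelCalculus` shape with `V₀ (y,u) = c₀ (y,u)`, `W_z (w,x) = c₁ (w − z, x − z)`: the leg `F` runs from `x = z + x′` to `y`,
the leg `R` from `u` to `w = z + w′` (row RHOA-3 of `LEAVES-FP.md` l.309; `RHOA-DESIGN.md` §3 (N-PC): `Π_n − K = −2·bubble(P,R_n) + bubble(R_n,R_n) − tadpole(R_n)`).

CONTENT ([folklore]).
* `hasSum_loc2_pow` ∕ `tsum_loc2_pow_le` — THE PRODUCT LETTERS: `Σ'_q (|c₀ q.1|L(q.1)^i)(|c₁ q.2|L(q.2)^j) = (Σ'|c₀|L^i)(Σ'|c₁|L^j) ≤ (C₀Θ_i)(C₁Θ_j)`,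
  `L(p) = (|p.1|₁+1)+(|p.2|₁+1)`, `Θ_m = 2^{m+1}(m!e^{δ/2}(2/δ)^m)e^{δ/2}Zl D (δ/2)²`;
* `summable_cross_of_bounded`, `abs_tsum_cross_le_of_pow` (`|Ψ q| ≤ M·L(q.1)^K·L(q.2)^K ⟹ |Σ' c₀ q.1·c₁ q.2·Ψ q| ≤ M·(C₀Θ_K)(C₁Θ_K)`), `summable_cross`;
* **`tsum_cross₂_eq_tsum_mixed` ∕ `tsum_cross_eq_tsum_mixed` — THE DOUBLE ZERO-MASS IDENTITY** (two-point first leg `F₂ (z+x′) y` ∕ translation-invariant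
  `F(z+x′−y)`): `Σ'c₀ = 0 ∧ Σ'c₁ = 0 ⟹ X(z) = Σ' c₀ q.1·c₁ q.2·Φ_z q`, `Φ_z q = G q − G (0,q.2) − G (q.1,0) + G (0,0)`, `G q = F₂ (z+x′) y·R u (z+w′)` (the three
  subtracted families have zero sum); `summable_cross₂` ∕ `summable_cross`;
* `mixed_split₂` ∕ `mixed_split` — the algebraic split `Φ_z = T1 + T2 + T3 + T4`: T1 = (MIXED second difference of the first leg)·`R`, T2∕T3 = (first difference of
  the first leg)·(first difference of `R` in its second∕first argument), T4 = (first leg at the base points)·(MIXED second difference of `R`, one step in each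
  argument) — the `(R′,R)` twin of PART 2 uses the two-point form.
Unit `b2b-balaban-gan24-formalise-leaf-05` (gen 36; cross-lane idle G-an2-4 swarm leaf seat on road FP), 2026-08-20; journal INTENT ∕ CLAIM «RHOA-3» l.23369.
-/

noncomputable section

namespace Summit.QuantumFields.BalabanUV.Beta.FP.NearRegionCrossBubbleSmear

open Finset Filter Topology
open scoped BigOperators
open Literature.MathematicalPhysics.QuantumFieldTheory.Balaban1983to89
open Literature.MathematicalPhysics.QuantumFieldTheory.Balaban1983to89.Beta
open B12Sec2to5 (l1 l1_nonneg)
open ExpKernelCalculus (Site Zl Zl_pos)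
open Summit.QuantumFields.BalabanUV.Beta.FP.ExpLocalisedBubble

variable {D : ℕ}

/-! ## The cross smear: summability, product letters, the double zero-mass identity -/

section Cross

variable {c₀ c₁ : Site D × Site D → ℝ} {C₀ C₁ δ : ℝ}

/-- [folklore] THE PRODUCT LETTERS (HasSum form): for two localised weights and exponents `i, j`, the four-point family
`q ↦ (|c₀ q.1|·L(q.1)^i)·(|c₁ q.2|·L(q.2)^j)`, `L(p) := (|p.1|₁+1)+(|p.2|₁+1)`, has sum `(Σ'|c₀|L^i)·(Σ'|c₁|L^j)`. -/
theorem hasSum_loc2_pow (hδ : 0 < δ) (hc₀ : ∀ p : Site D × Site D, |c₀ p| ≤ C₀ * (Real.exp (-δ * l1 p.1) * Real.exp (-δ * l1 p.2)))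
    (hc₁ : ∀ p : Site D × Site D, |c₁ p| ≤ C₁ * (Real.exp (-δ * l1 p.1) * Real.exp (-δ * l1 p.2))) (i j : ℕ) :
    HasSum (fun q : (Site D × Site D) × (Site D × Site D) =>
        (|c₀ q.1| * ((l1 q.1.1 + 1) + (l1 q.1.2 + 1)) ^ i) * (|c₁ q.2| * ((l1 q.2.1 + 1) + (l1 q.2.2 + 1)) ^ j))
      ((∑' p : Site D × Site D, |c₀ p| * ((l1 p.1 + 1) + (l1 p.2 + 1)) ^ i)
        * (∑' p : Site D × Site D, |c₁ p| * ((l1 p.1 + 1) + (l1 p.2 + 1)) ^ j)) := by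
  have h0 := summable_loc_mul_pow hδ hc₀ i
  have h1 := summable_loc_mul_pow hδ hc₁ j
  have hprod := h0.mul_of_nonneg h1 (fun p => by have := l1_nonneg p.1; have := l1_nonneg p.2; positivity)
    (fun p => by have := l1_nonneg p.1; have := l1_nonneg p.2; positivity)
  have e := h0.tsum_mul_tsum h1 hprod
  rw [e]
  exact hprod.hasSum

/-- [folklore] THE PRODUCT LETTERS (value): `Σ'_q (|c₀ q.1|L(q.1)^i)(|c₁ q.2|L(q.2)^j) ≤ (C₀·Θ_i)·(C₁·Θ_j)`, `Θ_m := 2^{m+1}(m!e^{δ/2}(2/δ)^m)e^{δ/2}Zl D (δ/2)²`. -/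
theorem tsum_loc2_pow_le (hδ : 0 < δ) (hc₀ : ∀ p : Site D × Site D, |c₀ p| ≤ C₀ * (Real.exp (-δ * l1 p.1) * Real.exp (-δ * l1 p.2)))
    (hc₁ : ∀ p : Site D × Site D, |c₁ p| ≤ C₁ * (Real.exp (-δ * l1 p.1) * Real.exp (-δ * l1 p.2))) (i j : ℕ) :
    ∑' q : (Site D × Site D) × (Site D × Site D),
        (|c₀ q.1| * ((l1 q.1.1 + 1) + (l1 q.1.2 + 1)) ^ i) * (|c₁ q.2| * ((l1 q.2.1 + 1) + (l1 q.2.2 + 1)) ^ j)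
      ≤ (C₀ * (2 ^ (i + 1) * ((i.factorial : ℝ) * Real.exp (δ / 2) * (2 / δ) ^ i) * Real.exp (δ / 2) * Zl D (δ / 2) ^ 2))
        * (C₁ * (2 ^ (j + 1) * ((j.factorial : ℝ) * Real.exp (δ / 2) * (2 / δ) ^ j) * Real.exp (δ / 2) * Zl D (δ / 2) ^ 2)) := by
  rw [(hasSum_loc2_pow hδ hc₀ hc₁ i j).tsum_eq]
  have h0 := tsum_loc_mul_pow_le hδ hc₀ i
  have h1 := tsum_loc_mul_pow_le hδ hc₁ j
  have hn1 : 0 ≤ ∑' p : Site D × Site D, |c₁ p| * ((l1 p.1 + 1) + (l1 p.2 + 1)) ^ j :=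
    tsum_nonneg fun p => by have := l1_nonneg p.1; have := l1_nonneg p.2; positivity
  have hC₀ := nonneg_of_loc hc₀
  have hZ : 0 < Zl D (δ / 2) := Zl_pos (half_pos hδ)
  exact mul_le_mul h0 h1 hn1 (by positivity)

variable {Ψ : (Site D × Site D) × (Site D × Site D) → ℝ} {M : ℝ}

/-- [folklore] A four-point family `q ↦ c₀ q.1 · c₁ q.2 · Ψ q` with `Ψ` bounded is summable. -/
theorem summable_cross_of_bounded (hδ : 0 < δ) (hc₀ : ∀ p : Site D × Site D, |c₀ p| ≤ C₀ * (Real.exp (-δ * l1 p.1) * Real.exp (-δ * l1 p.2)))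
    (hc₁ : ∀ p : Site D × Site D, |c₁ p| ≤ C₁ * (Real.exp (-δ * l1 p.1) * Real.exp (-δ * l1 p.2)))
    (hΨ : ∀ q, |Ψ q| ≤ M) :
    Summable fun q : (Site D × Site D) × (Site D × Site D) => c₀ q.1 * c₁ q.2 * Ψ q := by
  have hM : 0 ≤ M := (abs_nonneg _).trans (hΨ ((0, 0), (0, 0)))
  have h := (hasSum_loc2_pow hδ hc₀ hc₁ 0 0).summable.mul_right M
  refine Summable.of_norm_bounded h (fun q => ?_)
  rw [Real.norm_eq_abs, abs_mul, abs_mul]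
  simp only [pow_zero, mul_one]
  exact mul_le_mul_of_nonneg_left (hΨ q) (by positivity)

/-- [folklore] … and its sum is bounded by `M·(Σ'|c₀|)·(Σ'|c₁|) ≤ M·(C₀Θ₀)(C₁Θ₀)`; displayed with the general letter `Θ_K²` for any `K` (since `L ≥ 1`):
`|Σ' c₀ q.1·c₁ q.2·Ψ q| ≤ M·(C₀Θ_K)(C₁Θ_K)` whenever `|Ψ q| ≤ M·L(q.1)^K·L(q.2)^K`. -/
theorem abs_tsum_cross_le_of_pow (hδ : 0 < δ) (hc₀ : ∀ p : Site D × Site D, |c₀ p| ≤ C₀ * (Real.exp (-δ * l1 p.1) * Real.exp (-δ * l1 p.2)))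
    (hc₁ : ∀ p : Site D × Site D, |c₁ p| ≤ C₁ * (Real.exp (-δ * l1 p.1) * Real.exp (-δ * l1 p.2)))
    (hM : 0 ≤ M) (K : ℕ)
    (hΨ : ∀ q : (Site D × Site D) × (Site D × Site D),
      |Ψ q| ≤ M * ((l1 q.1.1 + 1) + (l1 q.1.2 + 1)) ^ K * ((l1 q.2.1 + 1) + (l1 q.2.2 + 1)) ^ K) :
    |∑' q : (Site D × Site D) × (Site D × Site D), c₀ q.1 * c₁ q.2 * Ψ q|
      ≤ M * ((C₀ * (2 ^ (K + 1) * ((K.factorial : ℝ) * Real.exp (δ / 2) * (2 / δ) ^ K) * Real.exp (δ / 2) * Zl D (δ / 2) ^ 2))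
        * (C₁ * (2 ^ (K + 1) * ((K.factorial : ℝ) * Real.exp (δ / 2) * (2 / δ) ^ K) * Real.exp (δ / 2) * Zl D (δ / 2) ^ 2))) := by
  have HM := (hasSum_loc2_pow hδ hc₀ hc₁ K K).mul_left M
  have hb := tsum_of_norm_bounded HM (f := fun q : (Site D × Site D) × (Site D × Site D) => c₀ q.1 * c₁ q.2 * Ψ q) (fun q => by
    rw [Real.norm_eq_abs, abs_mul, abs_mul]
    have := l1_nonneg q.1.1; have := l1_nonneg q.1.2; have := l1_nonneg q.2.1; have := l1_nonneg q.2.2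
    calc |c₀ q.1| * |c₁ q.2| * |Ψ q|
        ≤ |c₀ q.1| * |c₁ q.2| * (M * ((l1 q.1.1 + 1) + (l1 q.1.2 + 1)) ^ K * ((l1 q.2.1 + 1) + (l1 q.2.2 + 1)) ^ K) :=
          mul_le_mul_of_nonneg_left (hΨ q) (by positivity)
      _ = M * ((|c₀ q.1| * ((l1 q.1.1 + 1) + (l1 q.1.2 + 1)) ^ K) * (|c₁ q.2| * ((l1 q.2.1 + 1) + (l1 q.2.2 + 1)) ^ K)) := by ring)
  rw [Real.norm_eq_abs] at hb
  have hle := tsum_loc2_pow_le hδ hc₀ hc₁ K K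
  rw [(hasSum_loc2_pow hδ hc₀ hc₁ K K).tsum_eq] at hle
  exact hb.trans (mul_le_mul_of_nonneg_left hle hM)

variable {F₂ : Site D → Site D → ℝ} {F : Site D → ℝ} {R : Site D → Site D → ℝ} {A₀ B₀ : ℝ}

/-- [folklore] THE CROSS SMEAR (two-point first leg `F₂ x y`, leg from `x = z + x′` to `y`) IS SUMMABLE for bounded legs. -/
theorem summable_cross₂ (hδ : 0 < δ) (hc₀ : ∀ p : Site D × Site D, |c₀ p| ≤ C₀ * (Real.exp (-δ * l1 p.1) * Real.exp (-δ * l1 p.2)))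
    (hc₁ : ∀ p : Site D × Site D, |c₁ p| ≤ C₁ * (Real.exp (-δ * l1 p.1) * Real.exp (-δ * l1 p.2)))
    (hA : ∀ x y, |F₂ x y| ≤ A₀) (hR : ∀ u w, |R u w| ≤ B₀) (z : Site D) :
    Summable fun q : (Site D × Site D) × (Site D × Site D) => c₀ q.1 * c₁ q.2 * (F₂ (z + q.2.2) q.1.1 * R q.1.2 (z + q.2.1)) := by
  have hA0 : 0 ≤ A₀ := (abs_nonneg _).trans (hA z z)
  refine summable_cross_of_bounded hδ hc₀ hc₁ (M := A₀ * B₀) (fun q => ?_)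
  rw [abs_mul]
  exact mul_le_mul (hA _ _) (hR _ _) (abs_nonneg _) hA0

/-- [folklore] **THE DOUBLE ZERO-MASS IDENTITY** (two-point first leg): if both weights have zero total mass, the cross smear equals the smear of the
doubly-subtracted integrand `Φ_z q = G q − G (0,q.2) − G (q.1,0) + G (0,0)`, `G q := F₂ (z + x′) y · R u (z + w′)` (`q = ((y,u),(w′,x′))`): the three
subtracted families have zero sum (`(Σ'c₀)·(…)`, `(…)·(Σ'c₁)`, `(Σ'c₀)(Σ'c₁)·(…)`, `Summable.tsum_mul_tsum`). -/
theorem tsum_cross₂_eq_tsum_mixed (hδ : 0 < δ) (hc₀ : ∀ p : Site D × Site D, |c₀ p| ≤ C₀ * (Real.exp (-δ * l1 p.1) * Real.exp (-δ * l1 p.2)))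
    (hc₁ : ∀ p : Site D × Site D, |c₁ p| ≤ C₁ * (Real.exp (-δ * l1 p.1) * Real.exp (-δ * l1 p.2)))
    (h0 : ∑' p : Site D × Site D, c₀ p = 0) (h1 : ∑' p : Site D × Site D, c₁ p = 0)
    (hA : ∀ x y, |F₂ x y| ≤ A₀) (hR : ∀ u w, |R u w| ≤ B₀) (z : Site D) :
    ∑' q : (Site D × Site D) × (Site D × Site D), c₀ q.1 * c₁ q.2 * (F₂ (z + q.2.2) q.1.1 * R q.1.2 (z + q.2.1))
      = ∑' q : (Site D × Site D) × (Site D × Site D), c₀ q.1 * c₁ q.2 *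
          (F₂ (z + q.2.2) q.1.1 * R q.1.2 (z + q.2.1) - F₂ (z + q.2.2) 0 * R 0 (z + q.2.1) - F₂ z q.1.1 * R q.1.2 z + F₂ z 0 * R 0 z) := by
  have hA0 : 0 ≤ A₀ := (abs_nonneg _).trans (hA z z)
  have hw₀ := summable_weight hδ hc₀
  have hw₁ := summable_weight hδ hc₁
  -- the four summable families
  have hS := summable_cross₂ hδ hc₀ hc₁ hA hR z
  have hS1 : Summable fun q : (Site D × Site D) × (Site D × Site D) => c₀ q.1 * c₁ q.2 * (F₂ (z + q.2.2) 0 * R 0 (z + q.2.1)) :=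
    summable_cross_of_bounded hδ hc₀ hc₁ (M := A₀ * B₀) (fun q => by
      rw [abs_mul]; exact mul_le_mul (hA _ _) (hR _ _) (abs_nonneg _) hA0)
  have hS2 : Summable fun q : (Site D × Site D) × (Site D × Site D) => c₀ q.1 * c₁ q.2 * (F₂ z q.1.1 * R q.1.2 z) :=
    summable_cross_of_bounded hδ hc₀ hc₁ (M := A₀ * B₀) (fun q => by
      rw [abs_mul]; exact mul_le_mul (hA _ _) (hR _ _) (abs_nonneg _) hA0)
  have hS3 : Summable fun q : (Site D × Site D) × (Site D × Site D) => c₀ q.1 * c₁ q.2 * (F₂ z 0 * R 0 z) :=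
    summable_cross_of_bounded hδ hc₀ hc₁ (M := A₀ * B₀) (fun q => by
      rw [abs_mul]; exact mul_le_mul (hA _ _) (hR _ _) (abs_nonneg _) hA0)
  -- the three subtracted sums vanish
  have hg₁ : Summable fun p : Site D × Site D => c₁ p * (F₂ (z + p.2) 0 * R 0 (z + p.1)) := by
    refine Summable.of_norm_bounded (hw₁.abs.mul_right (A₀ * B₀)) (fun p => ?_)
    rw [Real.norm_eq_abs, abs_mul, abs_mul]
    calc |c₁ p| * (|F₂ (z + p.2) 0| * |R 0 (z + p.1)|) ≤ |c₁ p| * (A₀ * B₀) :=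
          mul_le_mul_of_nonneg_left (mul_le_mul (hA _ _) (hR _ _) (abs_nonneg _) hA0) (abs_nonneg _)
      _ = _ := rfl
  have hg₀ : Summable fun p : Site D × Site D => c₀ p * (F₂ z p.1 * R p.2 z) := by
    refine Summable.of_norm_bounded (hw₀.abs.mul_right (A₀ * B₀)) (fun p => ?_)
    rw [Real.norm_eq_abs, abs_mul, abs_mul]
    calc |c₀ p| * (|F₂ z p.1| * |R p.2 z|) ≤ |c₀ p| * (A₀ * B₀) :=
          mul_le_mul_of_nonneg_left (mul_le_mul (hA _ _) (hR _ _) (abs_nonneg _) hA0) (abs_nonneg _)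
      _ = _ := rfl
  have e1 : ∑' q : (Site D × Site D) × (Site D × Site D), c₀ q.1 * c₁ q.2 * (F₂ (z + q.2.2) 0 * R 0 (z + q.2.1)) = 0 := by
    have hfg : Summable fun q : (Site D × Site D) × (Site D × Site D) => c₀ q.1 * (c₁ q.2 * (F₂ (z + q.2.2) 0 * R 0 (z + q.2.1))) :=
      hS1.congr fun q => by ring
    have e := hw₀.tsum_mul_tsum hg₁ hfg
    rw [h0, zero_mul] at e
    calc ∑' q : (Site D × Site D) × (Site D × Site D), c₀ q.1 * c₁ q.2 * (F₂ (z + q.2.2) 0 * R 0 (z + q.2.1))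
        = ∑' q : (Site D × Site D) × (Site D × Site D), c₀ q.1 * (c₁ q.2 * (F₂ (z + q.2.2) 0 * R 0 (z + q.2.1))) :=
          tsum_congr fun q => by ring
      _ = 0 := e.symm
  have e2 : ∑' q : (Site D × Site D) × (Site D × Site D), c₀ q.1 * c₁ q.2 * (F₂ z q.1.1 * R q.1.2 z) = 0 := by
    have hfg : Summable fun q : (Site D × Site D) × (Site D × Site D) => (c₀ q.1 * (F₂ z q.1.1 * R q.1.2 z)) * c₁ q.2 :=
      hS2.congr fun q => by ring
    have e := hg₀.tsum_mul_tsum hw₁ hfg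
    rw [h1, mul_zero] at e
    calc ∑' q : (Site D × Site D) × (Site D × Site D), c₀ q.1 * c₁ q.2 * (F₂ z q.1.1 * R q.1.2 z)
        = ∑' q : (Site D × Site D) × (Site D × Site D), (c₀ q.1 * (F₂ z q.1.1 * R q.1.2 z)) * c₁ q.2 :=
          tsum_congr fun q => by ring
      _ = 0 := e.symm
  have e3 : ∑' q : (Site D × Site D) × (Site D × Site D), c₀ q.1 * c₁ q.2 * (F₂ z 0 * R 0 z) = 0 := by
    have hfg : Summable fun q : (Site D × Site D) × (Site D × Site D) => c₀ q.1 * c₁ q.2 :=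
      (summable_cross_of_bounded hδ hc₀ hc₁ (Ψ := fun _ => (1 : ℝ)) (M := 1) (fun _ => by simp)).congr fun q => by ring
    have e := hw₀.tsum_mul_tsum hw₁ hfg
    rw [h0, zero_mul] at e
    rw [tsum_mul_right, ← e, zero_mul]
  -- assemble
  have esplit : ∀ q : (Site D × Site D) × (Site D × Site D),
      c₀ q.1 * c₁ q.2 * (F₂ (z + q.2.2) q.1.1 * R q.1.2 (z + q.2.1) - F₂ (z + q.2.2) 0 * R 0 (z + q.2.1) - F₂ z q.1.1 * R q.1.2 z + F₂ z 0 * R 0 z)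
        = c₀ q.1 * c₁ q.2 * (F₂ (z + q.2.2) q.1.1 * R q.1.2 (z + q.2.1)) - c₀ q.1 * c₁ q.2 * (F₂ (z + q.2.2) 0 * R 0 (z + q.2.1))
          - c₀ q.1 * c₁ q.2 * (F₂ z q.1.1 * R q.1.2 z) + c₀ q.1 * c₁ q.2 * (F₂ z 0 * R 0 z) := fun q => by ring
  rw [tsum_congr esplit, ((hS.sub hS1).sub hS2).tsum_add hS3, (hS.sub hS1).tsum_sub hS2, hS.tsum_sub hS1, e1, e2, e3]
  ring

/-- [folklore] THE FOUR-TERM SPLIT of the doubly-subtracted integrand (two-point first leg; pure algebra): with `G q = F₂ (z+x′) y·R u (z+w′)`,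
`Φ_z = T1 + T2 + T3 + T4`, T1 = `[F₂ (z+x′) y − F₂ (z+x′) 0 − F₂ z y + F₂ z 0]·R u (z+w′)` (MIXED second difference of `F₂`, one step in each argument),
T2 = `[F₂ z y − F₂ z 0]·[R u (z+w′) − R u z]`, T3 = `[F₂ (z+x′) 0 − F₂ z 0]·[R u (z+w′) − R 0 (z+w′)]`, T4 = `F₂ z 0·[R u (z+w′) − R 0 (z+w′) − R u z + R 0 z]`. -/
theorem mixed_split₂ (F₂ : Site D → Site D → ℝ) (R : Site D → Site D → ℝ) (z y u w' x' : Site D) :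
    F₂ (z + x') y * R u (z + w') - F₂ (z + x') 0 * R 0 (z + w') - F₂ z y * R u z + F₂ z 0 * R 0 z
      = (F₂ (z + x') y - F₂ (z + x') 0 - F₂ z y + F₂ z 0) * R u (z + w')
        + (F₂ z y - F₂ z 0) * (R u (z + w') - R u z)
        + (F₂ (z + x') 0 - F₂ z 0) * (R u (z + w') - R 0 (z + w'))
        + F₂ z 0 * (R u (z + w') - R 0 (z + w') - R u z + R 0 z) := by
  ring

/-- [folklore] THE CROSS SMEAR IS SUMMABLE for bounded legs (translation-invariant first leg `F (x − y)`). -/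
theorem summable_cross (hδ : 0 < δ) (hc₀ : ∀ p : Site D × Site D, |c₀ p| ≤ C₀ * (Real.exp (-δ * l1 p.1) * Real.exp (-δ * l1 p.2)))
    (hc₁ : ∀ p : Site D × Site D, |c₁ p| ≤ C₁ * (Real.exp (-δ * l1 p.1) * Real.exp (-δ * l1 p.2)))
    (hA : ∀ t, |F t| ≤ A₀) (hR : ∀ u w, |R u w| ≤ B₀) (z : Site D) :
    Summable fun q : (Site D × Site D) × (Site D × Site D) => c₀ q.1 * c₁ q.2 * (F (z + q.2.2 - q.1.1) * R q.1.2 (z + q.2.1)) :=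
  summable_cross₂ (F₂ := fun x y => F (x - y)) hδ hc₀ hc₁ (fun _ _ => hA _) hR z

/-- [folklore] **THE DOUBLE ZERO-MASS IDENTITY** (translation-invariant first leg): if both weights have zero total mass, the cross smear equals the smear of
the doubly-subtracted integrand `Φ_z q = G q − G (0,q.2) − G (q.1,0) + G (0,0)`, `G q := F(z + x′ − y)·R u (z + w′)` (`q = ((y,u),(w′,x′))`). -/
theorem tsum_cross_eq_tsum_mixed (hδ : 0 < δ) (hc₀ : ∀ p : Site D × Site D, |c₀ p| ≤ C₀ * (Real.exp (-δ * l1 p.1) * Real.exp (-δ * l1 p.2)))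
    (hc₁ : ∀ p : Site D × Site D, |c₁ p| ≤ C₁ * (Real.exp (-δ * l1 p.1) * Real.exp (-δ * l1 p.2)))
    (h0 : ∑' p : Site D × Site D, c₀ p = 0) (h1 : ∑' p : Site D × Site D, c₁ p = 0)
    (hA : ∀ t, |F t| ≤ A₀) (hR : ∀ u w, |R u w| ≤ B₀) (z : Site D) :
    ∑' q : (Site D × Site D) × (Site D × Site D), c₀ q.1 * c₁ q.2 * (F (z + q.2.2 - q.1.1) * R q.1.2 (z + q.2.1))
      = ∑' q : (Site D × Site D) × (Site D × Site D), c₀ q.1 * c₁ q.2 *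
          (F (z + q.2.2 - q.1.1) * R q.1.2 (z + q.2.1) - F (z + q.2.2) * R 0 (z + q.2.1) - F (z - q.1.1) * R q.1.2 z + F z * R 0 z) := by
  have h := tsum_cross₂_eq_tsum_mixed (F₂ := fun x y => F (x - y)) hδ hc₀ hc₁ h0 h1 (fun _ _ => hA _) hR z
  simp only [sub_zero] at h
  exact h

/-- [folklore] THE FOUR-TERM SPLIT of the doubly-subtracted integrand (translation-invariant first leg; pure algebra): with `G q = F(z+x′−y)·R u (z+w′)`,
`Φ_z = T1 + T2 + T3 + T4` where T1 = `[F(z+x′−y) − F(z+x′) − F(z−y) + F z]·R u (z+w′)` (mixed second difference of `F`),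
T2 = `[F(z−y) − F z]·[R u (z+w′) − R u z]`, T3 = `[F(z+x′) − F z]·[R u (z+w′) − R 0 (z+w′)]`, T4 = `F z·[R u (z+w′) − R 0 (z+w′) − R u z + R 0 z]`. -/
theorem mixed_split (F : Site D → ℝ) (R : Site D → Site D → ℝ) (z y u w' x' : Site D) :
    F (z + x' - y) * R u (z + w') - F (z + x') * R 0 (z + w') - F (z - y) * R u z + F z * R 0 z
      = (F (z + x' - y) - F (z + x') - F (z - y) + F z) * R u (z + w')
        + (F (z - y) - F z) * (R u (z + w') - R u z)
        + (F (z + x') - F z) * (R u (z + w') - R 0 (z + w'))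
        + F z * (R u (z + w') - R 0 (z + w') - R u z + R 0 z) := by
  ring

end Cross

end Summit.QuantumFields.BalabanUV.Beta.FP.NearRegionCrossBubbleSmear

end
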